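import Literature.MeasureTheory.Group.BruhatFunction          -- ★ `exists_cutoff_fiberIntegral_pos`; brings `fiberIntegral`, `continuous_fiberIntegral`, `fiberIntegral_comp_mk_mul`
import HarnessLib

/-!
# A LOCAL Bruhat cut-off: a compactly supported continuous `β ≥ 0` on `G` whose fibre integrals `∫_H β(g h) dρ(h)` equal `1` over a prescribed compact set of `G ⧸ H`

Topic `MeasureTheory/Group`; namespace `Literature.MeasureTheory.Group`.  THEOREMS ONLY (no `def`, no instance, no notation, no axiom, no `sorry`).
Cell `pub/hodgecm-mathlib`, ENGINE T1 (crux H413 = `stmt-HodgeConjecture-24833`); generic measure theory, count-neutral; written for the in-house road to the letter (J-nc)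
`ArchLimitFormulaNoncompactWall` (ROAD-Sd, step (γ)(1) of the interchange (d3): LEAD F0P3a-plan (g9) WORDS T8-28 (1) ∕ T8-31 (1), 2026-09-01); author F0P3a-p06 (g10).

THE POINT.  The tree's `IsBruhatFunction` (★ `BruhatFunction`) is GLOBAL — `∫_H β(g h) dρ(h) = 1` for every `g` — hence never compactly supported when `G ⧸ H` is not compact, so it
cannot serve as a weight INSIDE a test function.  For Harish-Chandra-type manipulations (turning `∫_{G ⧸ H}` of a family of `H`-orbital integrals into the orbital integral of ONE
averaged test function) one needs the LOCAL version: given a compact `C ⊆ G ⧸ H`, a `β ∈ C_c(G)`, `β ≥ 0`, with `∫_H β(g h) dρ(h) = 1` whenever `gH ∈ C` (and `≤ 1` always).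
CONSTRUCTION (Bourbaki, *Intégration* VII §2 no. 4, proof of Prop. 8; Deitmar–Echterhoff, Lemma 1.5.1; Folland, Lemma 2.47): take `η ∈ C_c(G)`, `0 ≤ η ≤ 1`, with `η^H > 0` on `C`
(★ `exists_cutoff_fiberIntegral_pos`); `U = {η^H > 0}` is open (★ `continuous_fiberIntegral`) and contains `C`; choose a compact closed `L` with `C ⊆ interior L`, `L ⊆ U`
(`exists_compact_closed_between`) and a Urysohn function `φ` on `G ⧸ H` (T₂ and locally compact for closed `H`), `φ = 1` on `C`, `φ = 0` off `interior L`, `0 ≤ φ ≤ 1`; put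
`β(g) = φ(gH) ∕ (η^H(gH) + 1 − φ(gH)) · η(g)`.  The denominator is positive EVERYWHERE (where `φ = 1` we are inside `L ⊆ U`), so `β` is continuous with `supp β ⊆ supp η`, and
`∫_H β(g h) dρ(h) = φ(gH) η^H(gH) ∕ (η^H(gH) + 1 − φ(gH))`, which is `1` on `C` and `≤ 1` everywhere.

WHAT IS PROVED: **`exists_hasCompactSupport_integral_mul_fiber_eq_one`** (raw integrals `∫ h : H, β (g * h) ∂ρ`) and its `fiberIntegral`-spelled twin
**`exists_hasCompactSupport_fiberIntegral_eq_one`**.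
HONEST LABEL: textbook; HC_CM is proved only modulo the printed citations until rung 0 closes and this file pays nothing by itself.

## References
* [Folland1995] G. B. Folland, *A Course in Abstract Harmonic Analysis* (1995), §2.6, Lemma 2.47, Prop. 2.48.
* [DeitmarEchterhoff2014] A. Deitmar, S. Echterhoff, *Principles of Harmonic Analysis*, 2nd ed. (2014), Lemma 1.5.1.
-/

set_option autoImplicit false

noncomputable section

open _root_.MeasureTheory _root_.MeasureTheory.Measure _root_.Topology Set Filter Function
open CompactlySupported

namespace Literature.MeasureTheory.Group

variable {G : Type*} [Group G] [TopologicalSpace G] [IsTopologicalGroup G] [LocallyCompactSpace G]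
  [SecondCountableTopology G] [T2Space G] (H : Subgroup G) [MeasurableSpace H] [BorelSpace H]
  (ρ : Measure H) [ρ.IsMulLeftInvariant] [IsFiniteMeasureOnCompacts ρ] [ρ.IsOpenPosMeasure]

/-- **LOCAL BRUHAT CUT-OFF** (raw-integral form): for a closed subgroup `H` of a second countable locally compact group `G`, a left-invariant measure `ρ` on `H` finite on
compacts and positive on opens, and a compact `C ⊆ G ⧸ H`, there is a continuous compactly supported `β ≥ 0` on `G` with `∫_H β(g h) dρ(h) ≤ 1` for all `g` and `= 1`
whenever `gH ∈ C`. [cite: Folland1995, §2.6 Lemma 2.47] [cite: DeitmarEchterhoff2014, Lemma 1.5.1] -/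
theorem exists_hasCompactSupport_integral_mul_fiber_eq_one (hH : IsClosed (H : Set G)) {C : Set (G ⧸ H)} (hC : IsCompact C) :
    ∃ β : G → ℝ, Continuous β ∧ HasCompactSupport β ∧ (∀ x, 0 ≤ β x) ∧ (∀ g : G, ∫ h : H, β (g * h) ∂ρ ≤ 1) ∧
      ∀ g : G, (QuotientGroup.mk g : G ⧸ H) ∈ C → ∫ h : H, β (g * h) ∂ρ = 1 := by
  haveI : IsClosed (H : Set G) := hH
  obtain ⟨η, hη0, -, hηpos⟩ := exists_cutoff_fiberIntegral_pos H ρ hH hC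
  have hηHc : Continuous (fiberIntegral H ρ η) := continuous_fiberIntegral H ρ hH η.continuous η.hasCompactSupport
  have hηH0 : ∀ x, 0 ≤ fiberIntegral H ρ η x := fun x => fiberIntegral_nonneg H ρ (fun y => hη0 y) x
  -- the open set `U = {η^H > 0}` contains `C`; a compact closed `L` with `C ⊆ interior L`, `L ⊆ U`
  have hUo : IsOpen {x : G ⧸ H | 0 < fiberIntegral H ρ η x} := isOpen_lt continuous_const hηHc
  obtain ⟨L, -, hLcl, hCL, hLU⟩ := exists_compact_closed_between hC hUo fun x hx => hηpos x hx
  -- Urysohn on `G ⧸ H`: `φ = 1` on `C`, `φ = 0` off `interior L`, `0 ≤ φ ≤ 1`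
  obtain ⟨φ, hφ1, hφ0, -, hφ01⟩ :=
    exists_continuous_one_zero_of_isCompact hC isOpen_interior.isClosed_compl (disjoint_compl_right_iff_subset.mpr hCL)
  -- the denominator `η^H + (1 - φ)` is positive everywhere
  have hden : ∀ x, 0 < fiberIntegral H ρ η x + (1 - φ x) := by
    intro x
    rcases (hφ01 x).2.lt_or_eq with hlt | heq
    · exact add_pos_of_nonneg_of_pos (hηH0 x) (sub_pos.mpr hlt)
    · have hx : x ∈ interior L := by
        by_contra hx
        have h0 : φ x = 0 := hφ0 hx
        rw [h0] at heq
        exact zero_ne_one heq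
      rw [heq, sub_self, add_zero]
      exact hLU (interior_subset hx)
  have hκc : Continuous fun x : G ⧸ H => φ x / (fiberIntegral H ρ η x + (1 - φ x)) :=
    φ.continuous.div (hηHc.add (continuous_const.sub φ.continuous)) fun x => (hden x).ne'
  -- the fibre integrals of `β = (κ ∘ π) · η`
  have hfib : ∀ g : G, ∫ h : H, φ (QuotientGroup.mk (g * h)) / (fiberIntegral H ρ η (QuotientGroup.mk (g * h)) + (1 - φ (QuotientGroup.mk (g * h)))) * η (g * h) ∂ρ =
      φ (QuotientGroup.mk g) / (fiberIntegral H ρ η (QuotientGroup.mk g) + (1 - φ (QuotientGroup.mk g))) * fiberIntegral H ρ η (QuotientGroup.mk g) := fun g => by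
    simpa only [fiberIntegral_mk] using
      fiberIntegral_comp_mk_mul H ρ (fun x : G ⧸ H => φ x / (fiberIntegral H ρ η x + (1 - φ x))) η g
  refine ⟨fun g => φ (QuotientGroup.mk g) / (fiberIntegral H ρ η (QuotientGroup.mk g) + (1 - φ (QuotientGroup.mk g))) * η g,
    (hκc.comp QuotientGroup.continuous_mk).mul η.continuous, η.hasCompactSupport.mul_left,
    fun g => mul_nonneg (div_nonneg (hφ01 _).1 (hden _).le) (hη0 g), fun g => ?_, fun g hg => ?_⟩
  · rw [hfib g, div_mul_eq_mul_div, div_le_one (hden _)]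
    nlinarith [hηH0 (QuotientGroup.mk g : G ⧸ H), (hφ01 (QuotientGroup.mk g : G ⧸ H)).1, (hφ01 (QuotientGroup.mk g : G ⧸ H)).2]
  · have h1 : φ (QuotientGroup.mk g) = 1 := hφ1 hg
    rw [hfib g, h1, sub_self, add_zero, one_div, inv_mul_cancel₀ (hηpos _ hg).ne']

/-- **LOCAL BRUHAT CUT-OFF** (`fiberIntegral`-spelled): the same `β`, with `fiberIntegral H ρ β ≤ 1` on `G ⧸ H` and `= 1` on the compact `C`.
[cite: Folland1995, §2.6 Lemma 2.47] [cite: DeitmarEchterhoff2014, Lemma 1.5.1] -/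
theorem exists_hasCompactSupport_fiberIntegral_eq_one (hH : IsClosed (H : Set G)) {C : Set (G ⧸ H)} (hC : IsCompact C) :
    ∃ β : G → ℝ, Continuous β ∧ HasCompactSupport β ∧ (∀ x, 0 ≤ β x) ∧ (∀ x, fiberIntegral H ρ β x ≤ 1) ∧ ∀ x ∈ C, fiberIntegral H ρ β x = 1 := by
  obtain ⟨β, hβc, hβs, hβ0, hle, heq⟩ := exists_hasCompactSupport_integral_mul_fiber_eq_one H ρ hH hC
  refine ⟨β, hβc, hβs, hβ0, fun x => ?_, fun x hx => ?_⟩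
  · obtain ⟨g, rfl⟩ := QuotientGroup.mk_surjective x
    rw [fiberIntegral_mk]; exact hle g
  · obtain ⟨g, rfl⟩ := QuotientGroup.mk_surjective x
    rw [fiberIntegral_mk]; exact heq g hx

end Literature.MeasureTheory.Group

end
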